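import Summits.BirchSwinnertonDyer.BirchSwinnertonDyer.Theorems.SylvesterTwoHeegnerIndexCoupledTelescopeReflectionFrame
import Summits.BirchSwinnertonDyer.BirchSwinnertonDyer.Theorems.SylvesterTwoHeegnerIndexCoupledTelescopeReflectionDeriv
import Summits.BirchSwinnertonDyer.BirchSwinnertonDyer.Theorems.SylvesterTwoHeegnerIndexCoupledTelescopeClassSystem
import Literature.NumberTheory.EllipticCurves.KolyvaginChiComponent
import HarnessLib

/-!
# The COUPLED Cassels–Tate telescope, LI: THE REFLECTION INPUT OF THE FRAME POINT `Pt n = κ₉⁻¹ ιe_n(D_{l(n)} y_n)`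
# (Gross 1991 Prop. 5.4 (1) on HSY's tower, transported to `E₉(K̄)`; crux `UpperOffV0HSYPlus`, stmt-BirchSwinnertonDyer-19804;
# plan (B) SIGNS, file B-III (IIIa))

The finite-level reflection (R) `exists_reflection_foldr_derivOp_sylvesterTower` carried to the frame curve `E₉(K̄)` through
the pinned transport `κ₉` and the level point map `ιe_n` by the coordinate algebra of (F1); with the frame facts the
instantiation (IIIb, `…ReflectionClasses`) needs:
* §1 frame facts for a lift `τ̃` of the conjugation `c` of `K` (`c ω = ω²`): cube-root `x`-scalings commute with `Γ_K`
  and preserve `E₉(K̄)^N` (`smul_scale_of_pow_three_eq_one`, `scale_mem_fixedPoints`); the character is inverted,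
  `ρ(τ̃ g τ̃) = ρ(g)²` (`rho_conjGalCMH_eq`); `τ̃ N τ̃ = N` for the level fixers (`conjGalCMH_mem_of_lift`); lifts of
  `σ ∈ 𝒢` act on `ιe` (`exists_lift_smul_embPoints_eq`);
* §2 ★ `exists_reflection_framePoint` — the REFLECTION INPUT `τ̃ • Pt = s • σ̃ • Pt + T + 4^κ • Z` (`T ∈ A_n` torsion,
  `Z ∈ A_n`) from (R) `exists_reflection_foldr_derivOp_sylvesterTower` transported by (F1) through `κ₉` and `ιe_n`;
Theorems only (no definition / named fact / instance / notation); nothing asserted on 19804; no stub closed;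
X12.CMAtTwo NOT proved; BSD not claimed for any curve.  Sources: [GrossLMS1991] §4, Prop. 5.3, Prop. 5.4;
[McCallumLMS1991] §4 (4)–(6), §5; [HuShuYin2019] §1 p. 4, §2 p. 8, §4.1.
-/

set_option linter.dupNamespace false -- Summits modules are `Summit.<Summit>.<Problem>…` by design
set_option autoImplicit false

noncomputable section

open scoped Classical

namespace Summit.BirchSwinnertonDyer.BirchSwinnertonDyer.Theorems.SylvesterTwoCMFlip

open WeierstrassCurve Field NumberField IsDedekindDomain Finset
open Literature.NumberTheory.EllipticCurves Literature.NumberTheory.GaloisRepresentations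
  Literature.NumberTheory.EllipticCurves.ModularForms
  Literature.NumberTheory.EllipticCurves.HuShuYin2019
  Literature.NumberTheory.EllipticCurves.KolyvaginCocycle
  Literature.NumberTheory.EllipticCurves.KolyvaginDescent
  Literature.NumberTheory.EllipticCurves.RingClassField
  Summit.BirchSwinnertonDyer.BirchSwinnertonDyer.Theorems.SylvesterTwoCMData
  Summit.BirchSwinnertonDyer.BirchSwinnertonDyer.Theorems.SylvesterTwoCoupledTelescope
  Summit.BirchSwinnertonDyer.Rank1Residual.X11b
  Summit.BirchSwinnertonDyer.Rank1Residual.X11b.RingClassTower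

variable {K : Type} [Field K] [NumberField K]

/-! ## §1 Frame facts for the lift of complex conjugation -/

section Frame

variable {c : K ≃ₐ[ℚ] K} {τ : AlgebraicClosure K ≃+* AlgebraicClosure K} {E : WeierstrassCurve ℚ}

/-- The Galois action on an affine geometric point is coordinatewise (definitionally). [folklore] -/
private theorem smul_some_eq' (g : Field.absoluteGaloisGroup K) {x y : AlgebraicClosure K}
    (h : ((E.baseChange K).baseChange (AlgebraicClosure K)).toAffine.Nonsingular x y) :
    ∃ h', @HSMul.hSMul (Field.absoluteGaloisGroup K) (geomPoints (E.baseChange K)) (geomPoints (E.baseChange K))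
        instHSMul g (Affine.Point.some x y h) =
      Affine.Point.some ((show AlgebraicClosure K ≃ₐ[K] AlgebraicClosure K from g) x)
        ((show AlgebraicClosure K ≃ₐ[K] AlgebraicClosure K from g) y) h' :=
  ⟨_, rfl⟩

/-- **Cube-root `x`-scalings commute with `Γ_K`** (`μ₃ ⊂ K`). [cite: HuShuYin2019, §1 p. 4] -/
theorem smul_scale_of_pow_three_eq_one {ω : K} (hω : ω ^ 2 + ω + 1 = 0)
    (S : geomPoints (E.baseChange K) ≃+ geomPoints (E.baseChange K)) {u : AlgebraicClosure K} (hu : u ^ 3 = 1)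
    (hS : ∀ (x y : AlgebraicClosure K) (h : ((E.baseChange K).baseChange (AlgebraicClosure K)).toAffine.Nonsingular x y),
      ∃ h', S (Affine.Point.some x y h) = Affine.Point.some (u * x) y h')
    (g : Field.absoluteGaloisGroup K) (P : geomPoints (E.baseChange K)) : g • S P = S (g • P) := by
  have hfix : (show AlgebraicClosure K ≃ₐ[K] AlgebraicClosure K from g) u = u :=
    JZero.apply_eq_self_of_pow_three_eq_one hω _ hu
  change ((E.baseChange K).baseChange (AlgebraicClosure K)).toAffine.Point at P
  rcases P with _ | ⟨x, y, hP⟩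
  · change g • S 0 = S (g • (0 : geomPoints (E.baseChange K)))
    rw [map_zero, smul_zero, map_zero]
  · obtain ⟨h₁, e₁⟩ := hS x y hP
    obtain ⟨h₂, e₂⟩ := smul_some_eq' g h₁
    obtain ⟨h₃, e₃⟩ := smul_some_eq' (E := E) g hP
    obtain ⟨h₄, e₄⟩ := hS _ _ h₃
    refine ((congrArg (g • ·) e₁).trans e₂).trans (Eq.symm (((congrArg S e₃).trans e₄).trans ?_))
    exact Affine.Point.some_eq_some_of_eq (by rw [map_mul, hfix]) rfl

/-- **Cube-root `x`-scalings preserve `E(K̄)^N`.** [cite: HuShuYin2019, §1 p. 4] -/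
theorem scale_mem_fixedPoints {ω : K} (hω : ω ^ 2 + ω + 1 = 0) (N : Subgroup (Field.absoluteGaloisGroup K))
    (S : geomPoints (E.baseChange K) ≃+ geomPoints (E.baseChange K)) (u : AlgebraicClosure K) (hu : u ^ 3 = 1)
    (hS : ∀ (x y : AlgebraicClosure K) (h : ((E.baseChange K).baseChange (AlgebraicClosure K)).toAffine.Nonsingular x y),
      ∃ h', S (Affine.Point.some x y h) = Affine.Point.some (u * x) y h') :
    ∀ a ∈ FixedPoints.addSubgroup N (geomPoints (E.baseChange K)), S a ∈ FixedPoints.addSubgroup N (geomPoints (E.baseChange K)) := by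
  intro a ha
  rw [JZero.mem_fixedPoints_iff] at ha ⊢
  intro h hh
  rw [smul_scale_of_pow_three_eq_one hω S hu hS, ha h hh]

/-- **The cubic character is inverted by `τ̃`: `ρ(τ̃ g τ̃) = ρ(g)²`** (`(τ̃ g τ̃)(v)/v = (g v / v)²` for `τ̃² = 1`,
`τ̃ ζ = ζ²`). [cite: GrossLMS1991, §5 (proof of Prop. 5.4: τ σ τ⁻¹ = σ⁻¹)] [cite: HuShuYin2019, §1 p. 4] -/
theorem rho_conjGalCMH_eq (hτ : IsLiftOfAut c τ) (hinv : ∀ x, τ (τ x) = x) {ω : K} (hω : ω ^ 2 + ω + 1 = 0)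
    (hcω : c ω = ω ^ 2) {v : AlgebraicClosure K} (hv : v ≠ 0) (hτv : (τ v) ^ 3 = v ^ 3)
    (hv3 : ∀ g : Field.absoluteGaloisGroup K, ((show AlgebraicClosure K ≃ₐ[K] AlgebraicClosure K from g) v) ^ 3 = v ^ 3)
    {ρ : Field.absoluteGaloisGroup K → geomPoints (E.baseChange K) ≃+ geomPoints (E.baseChange K)}
    (hρ : ∀ (g : Field.absoluteGaloisGroup K) {x y : AlgebraicClosure K}
      (h : ((E.baseChange K).baseChange (AlgebraicClosure K)).toAffine.Nonsingular x y),
      ∃ h', ρ g (Affine.Point.some x y h) =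
        Affine.Point.some (((show AlgebraicClosure K ≃ₐ[K] AlgebraicClosure K from g) v / v) ^ 2 * x) y h')
    (g : Field.absoluteGaloisGroup K) (Q : geomPoints (E.baseChange K)) :
    ρ (hτ.conjGalCMH g) Q = ρ g (ρ g Q) := by
  set χ := (show AlgebraicClosure K ≃ₐ[K] AlgebraicClosure K from g) v / v with hχ
  have hχ3 : χ ^ 3 = 1 := JZero.div_pow_three_eq_one hv (hv3 g)
  have hu₀3 : (τ v / v) ^ 3 = 1 := JZero.div_pow_three_eq_one hv hτv
  -- `(τ̃ g τ̃) v = χ² v`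
  have hval : (show AlgebraicClosure K ≃ₐ[K] AlgebraicClosure K from hτ.conjGalCMH g) v / v = χ ^ 2 := by
    have happ : (show AlgebraicClosure K ≃ₐ[K] AlgebraicClosure K from hτ.conjGalCMH g) v =
        τ.symm ((show AlgebraicClosure K ≃ₐ[K] AlgebraicClosure K from g) (τ v)) := rfl
    have hτv' : τ v = (τ v / v) * v := by rw [div_mul_cancel₀ _ hv]
    have hgv : (show AlgebraicClosure K ≃ₐ[K] AlgebraicClosure K from g) v = χ * v := by rw [hχ, div_mul_cancel₀ _ hv]
    rw [div_eq_iff hv, happ, hτv', map_mul, JZero.apply_eq_self_of_pow_three_eq_one hω _ hu₀3, hgv,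
      ringEquiv_symm_apply_of_involutive hinv, map_mul, map_mul, lift_apply_of_pow_three_eq_one hτ hω hcω hu₀3,
      lift_apply_of_pow_three_eq_one hτ hω hcω hχ3]
    calc (τ v / v) ^ 2 * (χ ^ 2 * τ v) = (τ v / v) ^ 2 * (χ ^ 2 * ((τ v / v) * v)) := by rw [div_mul_cancel₀ _ hv]
      _ = (τ v / v) ^ 3 * (χ ^ 2 * v) := by ring
      _ = χ ^ 2 * v := by rw [hu₀3, one_mul]
  refine eq_of_formula (F := ρ (hτ.conjGalCMH g)) (G := fun Q ↦ ρ g (ρ g Q)) (map_zero _) (by simp)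
    (formula_one_mul fun x y h ↦ hρ _ h)
    (comp_formula (F := ρ g) (G := ρ g) (formula_one_mul fun x y h ↦ hρ g h) (formula_one_mul fun x y h ↦ hρ g h))
    (by rw [hval]; ring) (by rw [one_mul]) Q

/-- **The level fixer is `τ̃`-stable**: `τ̃ h τ̃ ∈ N` for `h ∈ N = Gal(K̄/emb L)` when `τ̃ ∘ emb = emb ∘ τ_L`. [folklore] -/
theorem conjGalCMH_mem_of_lift (hτ : IsLiftOfAut c τ) {L : Type} [Field L] [CharZero L]
    (emb : L →+* AlgebraicClosure K) {τL : L ≃ₐ[ℚ] L} (hcomp : ∀ x : L, τ (emb x) = emb (τL x))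
    {N : Subgroup (Field.absoluteGaloisGroup K)}
    (hN : ∀ g : Field.absoluteGaloisGroup K, g ∈ N ↔
      ∀ x : L, (show AlgebraicClosure K ≃ₐ[K] AlgebraicClosure K from g) (emb x) = emb x)
    {h : Field.absoluteGaloisGroup K} (hh : h ∈ N) : hτ.conjGalCMH h ∈ N := by
  rw [hN]
  intro x
  change τ.symm ((show AlgebraicClosure K ≃ₐ[K] AlgebraicClosure K from h) (τ (emb x))) = emb x
  rw [hcomp, (hN h).mp hh, ← hcomp, RingEquiv.symm_apply_apply]

/-- **Elements of `𝒢 = Gal(K[m]/K)` lift to `Γ_K` and act on `ιe = Point.map emb`.** [cite: GrossLMS1991, §4 (4.2)] -/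
theorem exists_lift_smul_embPoints_eq (hK : IsImaginaryQuadratic K) (ι : K →+* ℂ) {m : ℕ} (hm : m ≠ 0)
    (W : WeierstrassCurve ℚ) (emb : ringClassField K ι m →+* AlgebraicClosure K)
    (hemb : ∀ k : K, emb (algebraMap K (ringClassField K ι m) k) = algebraMap K (AlgebraicClosure K) k)
    (ιe : letI : DecidableEq (ringClassField K ι m) := fun a b ↦ Classical.propDecidable (a = b)
      (W.baseChange (ringClassField K ι m)).toAffine.Point →+ geomPoints (W.baseChange K))
    (hιe : ∀ P, ιe P = Affine.Point.map (W' := W) emb.toRatAlgHom P)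
    {σ : ringClassField K ι m ≃ₐ[ℚ] ringClassField K ι m} (hσ : σ ∈ ringClassGal ι m) :
    ∃ g : Field.absoluteGaloisGroup K, ∀ P, g • ιe P = ιe (pointGalHom W (ringClassField K ι m) σ P) := by
  haveI := (finiteDimensional_and_isGalois_ringClassField hK ι hm).2
  let σK : ringClassField K ι m ≃ₐ[K] ringClassField K ι m :=
    { σ with commutes' := fun k ↦ smul_algebraMap_of_mem_ringClassGal hσ k }
  obtain ⟨g, hg⟩ := exists_lift_algEquiv emb hemb σK
  refine ⟨g, fun P ↦ ?_⟩
  rw [smul_embPoints_eq_of_comp W emb ιe hιe g (σ : ringClassField K ι m →+* ringClassField K ι m) (fun x ↦ hg x) P]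
  exact congrArg ιe (map_toRatAlgHom_eq_pointGalHom W σ P)

end Frame

/-! ## §2 The reflection input of the frame point `Pt = κ⁻¹ ιe (D_l y)` -/

set_option maxHeartbeats 800000 in
/-- ★ **THE REFLECTION INPUT at `E₉(K̄)`**: `τ̃ • Pt = s • σ̃ • Pt + T + m • Z` for `Pt = κ⁻¹ ιe(D_l y_n)`, with
`T ∈ E(K̄)^N` torsion and `Z ∈ E(K̄)^N` — (R) ★ at the reflection `τ_L ∉ 𝒢` of `K[9pn]` restricting `τ̃`, transported by
`κ` (`ℚ`-rational) and `ιe` (`τ̃ ∘ emb = emb ∘ τ_L`), the Galois partner `σ ∈ 𝒢` lifted to `σ̃ ∈ Γ_K`.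
[cite: GrossLMS1991, Prop. 5.3, Prop. 5.4 (1), §4 (4.2)] [cite: HuShuYin2019, §2 p. 8, §4.1] -/
theorem exists_reflection_framePoint (hK : IsImaginaryQuadratic K) (hdK : NumberField.discr K = -3) (ι : K →+* ℂ)
    {W E : WeierstrassCurve ℚ} [W.IsElliptic] (Dt : ModularParametrizationData W 243) {p n : ℕ} (hp : p % 3 = 1)
    (hn : n ≠ 0) (hn3 : ¬ 3 ∣ n) (hnC : IsCoprime (n : ℤ) (4 * (p : ℤ) ^ 2 + 18 * p + 81))
    (emb : ringClassField K ι (9 * p * n) →+* AlgebraicClosure K)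
    (hemb : ∀ k : K, emb (algebraMap K (ringClassField K ι (9 * p * n)) k) = algebraMap K (AlgebraicClosure K) k)
    (ιe : letI : DecidableEq (ringClassField K ι (9 * p * n)) := fun a b ↦ Classical.propDecidable (a = b)
      (W.baseChange (ringClassField K ι (9 * p * n))).toAffine.Point →+ geomPoints (W.baseChange K))
    (hιe : ∀ P, ιe P = Affine.Point.map (W' := W) emb.toRatAlgHom P)
    (N : Subgroup (Field.absoluteGaloisGroup K))
    (hN : ∀ g : Field.absoluteGaloisGroup K, g ∈ N ↔
      ∀ x : ringClassField K ι (9 * p * n), (show AlgebraicClosure K ≃ₐ[K] AlgebraicClosure K from g) (emb x) = emb x)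
    {y : (W.baseChange (ringClassField K ι (9 * p * n))).toAffine.Point}
    (hy : WeierstrassCurve.Affine.Point.map (W' := W) (ringClassField K ι (9 * p * n)).subtype.toRatAlgHom y =
      Dt.φ (heegnerTau ((n : ℤ) ^ 2 * (81 * ((p : ℤ) ^ 2 + 4 * p + 16)),
        (n : ℤ) * (-(9 * (4 * (p : ℤ) ^ 2 + 17 * p + 72))), 4 * (p : ℤ) ^ 2 + 18 * p + 81)))
    (l : List ((ringClassField K ι (9 * p * n) ≃ₐ[ℚ] ringClassField K ι (9 * p * n)) × ℕ))
    (hl : ∀ a ∈ l, a.1 ∈ ringClassGal ι (9 * p * n)) (hord : ∀ a ∈ l, a.1 ^ (a.2 + 1) = 1)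
    {m : ℤ} (hdvd : ∀ a ∈ l, m ∣ ((a.2 + 1 : ℕ) : ℤ))
    (κ : geomPoints (E.baseChange K) ≃+ geomPoints (W.baseChange K))
    (hκG : ∀ (g : Field.absoluteGaloisGroup K) (P : geomPoints (E.baseChange K)), κ (g • P) = g • κ P)
    (hκ : ∀ {x y : AlgebraicClosure K}
      (h : ((E.baseChange K).baseChange (AlgebraicClosure K)).toAffine.Nonsingular x y),
      ∃ h', κ (Affine.Point.some x y h) = Affine.Point.some (x / 36) ((y - 108) / 216) h')
    {c : K ≃ₐ[ℚ] K} {τ : AlgebraicClosure K ≃+* AlgebraicClosure K} (hτ : IsLiftOfAut c τ)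
    {τL : ringClassField K ι (9 * p * n) ≃ₐ[ℚ] ringClassField K ι (9 * p * n)}
    (hcomp : ∀ x, τ (emb x) = emb (τL x)) (hτL : τL ∉ ringClassGal ι (9 * p * n)) :
    ∃ (s : ℤ) (σ' : Field.absoluteGaloisGroup K), ∃ T ∈ FixedPoints.addSubgroup N (geomPoints (E.baseChange K)),
      IsOfFinAddOrder T ∧ ∃ Z ∈ FixedPoints.addSubgroup N (geomPoints (E.baseChange K)),
      hτ.pointsMap E (κ.symm (ιe (l.foldr (fun a x ↦ KolyvaginOperator.derivOp
        (pointGalHom W (ringClassField K ι (9 * p * n))) a.1 a.2 x) y))) =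
        s • σ' • κ.symm (ιe (l.foldr (fun a x ↦ KolyvaginOperator.derivOp
          (pointGalHom W (ringClassField K ι (9 * p * n))) a.1 a.2 x) y)) + T + m • Z := by
  have hp0 : p ≠ 0 := by rintro rfl; norm_num at hp
  have hN0 : 9 * p * n ≠ 0 := mul_ne_zero (mul_ne_zero (by norm_num) hp0) hn
  set Dy := l.foldr (fun a x ↦ KolyvaginOperator.derivOp (pointGalHom W (ringClassField K ι (9 * p * n))) a.1 a.2 x) y
    with hDy
  obtain ⟨σ, hσ, e, -, -, T₀, hT₀, Z₀, hrefl⟩ :=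
    exists_reflection_foldr_derivOp_sylvesterTower hK hdK ι Dt hp hn hn3 hnC hy l hl hord hdvd hτL
  rw [← hDy] at hrefl
  obtain ⟨g, hg⟩ := exists_lift_smul_embPoints_eq hK ι hN0 W emb hemb ιe hιe hσ
  have hκτ : ∀ Z, hτ.pointsMap E (κ.symm Z) = κ.symm (hτ.pointsMap W Z) := fun Z ↦ by
    apply κ.injective
    rw [← pointsMap_apply_of_frameFormula hτ (map_zero κ) hκ (κ.symm Z), κ.apply_symm_apply, κ.apply_symm_apply]
  have hκg : ∀ Z, g • κ.symm Z = κ.symm (g • Z) := fun Z ↦ by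
    apply κ.injective; rw [hκG, κ.apply_symm_apply, κ.apply_symm_apply]
  -- `ιe` through its dictionary `hιe` (the two `DecidableEq` presentations of `E(K[9pn])` agree on points)
  have hτι : hτ.pointsMap W (ιe Dy) = ιe (pointGalHom W (ringClassField K ι (9 * p * n)) τL Dy) :=
    pointsMap_embPoints_eq hτ emb ιe hιe τL hcomp Dy
  have hι_add : ∀ P Q, ιe (P + Q) = ιe P + ιe Q := fun P Q ↦ by rw [hιe, hιe, hιe, map_add]; rfl
  have hι_zsmul : ∀ (k : ℤ) P, ιe (k • P) = k • ιe P := fun k P ↦ by rw [hιe, hιe, map_zsmul]; rfl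
  have hιT : IsOfFinAddOrder (ιe T₀) := by rw [hιe]; exact AddMonoidHom.isOfFinAddOrder _ hT₀
  refine ⟨(-1) ^ l.length * e, g, κ.symm (ιe T₀),
    mem_fixedPoints_symm_of_equivariant κ hκG N (embPoints_mem_fixedPoints W emb ιe hιe N hN T₀),
    κ.symm.toAddMonoidHom.isOfFinAddOrder hιT, κ.symm (ιe Z₀),
    mem_fixedPoints_symm_of_equivariant κ hκG N (embPoints_mem_fixedPoints W emb ιe hιe N hN Z₀), ?_⟩
  rw [hκτ, hτι, hrefl, hι_add, hι_add, hι_zsmul, hι_zsmul, ← hg, map_add, map_add, map_zsmul, map_zsmul, ← hκg]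

end Summit.BirchSwinnertonDyer.BirchSwinnertonDyer.Theorems.SylvesterTwoCMFlip

end
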